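import Literature.AlgebraicGeometry.Resolution.WeightedResolutionDatum
import Literature.AlgebraicGeometry.Resolution.AlterationsNodeLocalStructure
import Literature.AlgebraicGeometry.Resolution.AlterationsNormalForm
import Summits.ResolutionOfSingularities.ResolutionOfSingularities.Theorems.WeightedInvariantWeightedConstructionExtReesBridge
import Summits.ResolutionOfSingularities.ResolutionOfSingularities.Theorems.WeightedInvariantWeightedConstructionCobordantBlowupRegular
import Mathlib.RingTheory.AdicCompletion.AsTensorProduct
import Mathlib.RingTheory.Flat.Localization
import Mathlib.RingTheory.RingHom.Flat
import Mathlib.RingTheory.Ideal.Colon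
import Mathlib.RingTheory.TensorProduct.Quotient
import HarnessLib

/-!
# The completed strict transform is the `t⁻¹`-saturation of the substituted ideal

Route `ResolutionOfSingularities/WeightedInvariant`, crux `WeightedConstruction`
(stmt-ResolutionOfSingularities-0571), line `support-first-weights-second`: the registered stub
`stub_formalStrictTransform` of the lead skeleton (formal-chart package).

Notation: `A = Γ(Y, U)`, `I = R.chartIdeals U`, `E = A[t⁻¹, Iₙ tⁿ] = extReesAlgebra I`, `s = t⁻¹`,
`B = Spec E = affineCobordantBlowup I`, `πY : B → Spec A ≅ U ⊆ Y`, `b ∈ B`, `y = πY b`, and for an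
ideal `𝔞 ≤ A` its strict transform `σˢ(𝔞) = {g ∈ E | sᵐ g ∈ 𝔞 E for some m}` (Włodarczyk 3.3.12,
`extReesAlgebra.mem_strictTransform_iff`). Given ring isomorphisms `eY : 𝒪̂_{Y,y} ≃ SY`,
`eB : 𝒪̂_{B,b} ≃ SB` and a map `Φ` with `eB ∘ (completed stalk map of πY) = Φ ∘ eY`, `eB(ŝ) = x₀`, the
image under `eB` of the completed stalk ideal of `σˢ(𝔞)` at `b` is `⋃_N (J : x₀ᴺ)` for the ideal `J`
generated by `Φ(eY(𝔞 𝒪̂_{Y,y}))`: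

* `colon_singleton_map_of_flat` — **colon ideals by an element commute with flat extension**,
  `(K T : x) = (K : x) T` for `A → T` flat (Matsumura Thm. 7.4: tensor the injection
  `A/(K : x) → A/K`, `r ↦ r x`, with `T`);
* `extReesAlgebra.map_strictTransform_eq_iSup_colon` — along a flat `ψ : E → T`,
  `σˢ(𝔞) T = ⋃_N (𝔞 T : ψ(s)ᴺ)`;
* `stalkMap_germ_π_fromSpec`, `map_germ_idealSheaf_ideal`, `flat_germ_comp_ΓSpecIso` — the stalk
  map of `πY` on germs of sections over `U`, the stalk of the ideal sheaf of an ideal of `E`, and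
  flatness of `E → 𝒪_{B,b}` (a localisation; the completion `𝒪_{B,b} → 𝒪̂_{B,b}` of a Noetherian
  local ring is flat by Mathlib's `AdicCompletion.flat_of_isNoetherian`);
* `map_completedStalkIdeal_idealSheaf_strictTransform` — the statement for any scheme `Y`, any
  filtration `I` on `Γ(Y, U)` with `𝒪_{B,b}` Noetherian and any targets `SY`, `SB`;
* `stub_formalStrictTransform` — the registered stub: `𝒪_{B(U),b}` is Noetherian because `B(U)` is
  regular (`stub_cobordantBlowup_regular`, `stub_extRees_bridge`, landed).
-/

noncomputable section

set_option linter.dupNamespace false -- mandated namespace of this single-conjunct summit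

open CategoryTheory CategoryTheory.Limits AlgebraicGeometry TopologicalSpace
open Literature.AlgebraicGeometry.Resolution
open scoped LaurentPolynomial TensorProduct

namespace Summit.ResolutionOfSingularities.ResolutionOfSingularities.Theorems

universe u

/-! ## Colon ideals along flat ring maps -/

/-- **Colon ideals by an element commute with flat base change** (Matsumura, Thm. 7.4 (ii), the case
of a principal ideal): for a flat `A`-algebra `T`, an ideal `K ≤ A` and `x ∈ A`,
`(K T : x) = (K : x) T`. The injection `A/(K : x) → A/K`, `r ↦ r x`, stays injective after
`T ⊗_A -`, i.e. `T/(K : x)T → T/KT`, `t ↦ t x`, is injective; the other inclusion is clear.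
[cite: Matsumura1987, Thm. 7.4] -/
theorem colon_singleton_map_of_flat {A T : Type*} [CommRing A] [CommRing T] [Algebra A T]
    [Module.Flat A T] (K : Ideal A) (x : A) :
    (K.map (algebraMap A T)).colon {algebraMap A T x} = (K.colon {x}).map (algebraMap A T) := by
  refine le_antisymm ?_ ?_
  · intro t ht
    rw [Submodule.mem_colon_singleton, smul_eq_mul] at ht
    -- the injection `A/(K : x) → A/K`, `r ↦ r x`
    let L : Ideal A := K.colon {x}
    let μ : (A ⧸ L) →ₗ[A] (A ⧸ K) :=
      Submodule.mapQ L K (LinearMap.mulRight A x) fun r hr => by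
        rw [Submodule.mem_comap, LinearMap.mulRight_apply]
        exact Submodule.mem_colon_singleton.mp hr
    have hμ : Function.Injective μ := by
      rw [← LinearMap.ker_eq_bot, LinearMap.ker_eq_bot']
      intro q hq
      obtain ⟨r, rfl⟩ := Submodule.Quotient.mk_surjective _ q
      rw [Submodule.mapQ_apply, LinearMap.mulRight_apply, Submodule.Quotient.mk_eq_zero] at hq
      exact (Submodule.Quotient.mk_eq_zero _).mpr (Submodule.mem_colon_singleton.mpr hq)
    have hinj := Module.Flat.lTensor_preserves_injective_linearMap (M := T) μ hμ
    let eL := (Algebra.TensorProduct.quotIdealMapEquivTensorQuot T L).toLinearEquiv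
    let eK := (Algebra.TensorProduct.quotIdealMapEquivTensorQuot T K).toLinearEquiv
    have key : (μ.lTensor T) (eL (Ideal.Quotient.mk _ t)) =
        eK (Ideal.Quotient.mk _ (t * algebraMap A T x)) := by
      have h1 : eL (Ideal.Quotient.mk _ t) = t ⊗ₜ[A] (Submodule.Quotient.mk 1) := rfl
      have h2 : eK (Ideal.Quotient.mk _ (t * algebraMap A T x)) =
          (t * algebraMap A T x) ⊗ₜ[A] (Submodule.Quotient.mk 1) := rfl
      have h3 : μ (Submodule.Quotient.mk 1) = x • (Submodule.Quotient.mk 1 : A ⧸ K) := by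
        rw [Submodule.mapQ_apply, LinearMap.mulRight_apply, one_mul, ← Submodule.Quotient.mk_smul,
          smul_eq_mul, mul_one]
      rw [h1, h2, LinearMap.lTensor_tmul, h3, ← TensorProduct.smul_tmul, Algebra.smul_def,
        mul_comm t]
    have h0 : (μ.lTensor T) (eL (Ideal.Quotient.mk _ t)) = 0 := by
      rw [key, Ideal.Quotient.eq_zero_iff_mem.mpr ht, map_zero]
    rw [← map_zero (μ.lTensor T)] at h0
    have h1 := hinj h0
    rw [← map_zero eL] at h1
    exact Ideal.Quotient.eq_zero_iff_mem.mp (eL.injective h1)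
  · rw [Ideal.map_le_iff_le_comap]
    intro r hr
    rw [Ideal.mem_comap, Submodule.mem_colon_singleton, smul_eq_mul, ← map_mul]
    exact Ideal.mem_map_of_mem _ (Submodule.mem_colon_singleton.mp hr)

/-- `colon_singleton_map_of_flat` for a flat ring homomorphism `φ`:
`(φ(K) T : φ x) = φ((K : x)) T`. [cite: Matsumura1987, Thm. 7.4] -/
theorem colon_singleton_map_of_ringHom_flat {A T : Type*} [CommRing A] [CommRing T]
    {φ : A →+* T} (hφ : φ.Flat) (K : Ideal A) (x : A) :
    (K.map φ).colon {φ x} = (K.colon {x}).map φ := by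
  algebraize [φ]
  exact colon_singleton_map_of_flat K x

/-! ## The strict transform along a flat map out of the extended Rees algebra -/

/-- **The strict transform extends to the `s`-saturation along flat maps**: for a filtration `I` on
`A`, an ideal `𝔞 ≤ A` and a FLAT ring map `ψ : A[t⁻¹, Iₙ tⁿ] → T`,
`σˢ(𝔞) T = ⋃_N (𝔞 T : ψ(t⁻¹)ᴺ)`: `σˢ(𝔞) = ⋃_N (𝔞 E : (t⁻¹)ᴺ)` (Włodarczyk 3.3.12) and each colon
ideal extends to the colon ideal (`colon_singleton_map_of_ringHom_flat`).
[cite: Wlodarczyk2022, 3.3.12] -/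
theorem extReesAlgebra.map_strictTransform_eq_iSup_colon {A : Type*} [CommRing A]
    (I : ℕ → Ideal A) {T : Type*} [CommRing T] {ψ : extReesAlgebra I →+* T} (hψ : ψ.Flat)
    (𝔞 : Ideal A) :
    (extReesAlgebra.strictTransform I 𝔞).map ψ =
      ⨆ N : ℕ, ((𝔞.map (algebraMap A (extReesAlgebra I))).map ψ).colon
        {ψ (extReesAlgebra.tInv I) ^ N} := by
  refine le_antisymm ?_ (iSup_le fun N => ?_)
  · rw [Ideal.map_le_iff_le_comap]
    intro g hg
    obtain ⟨m, hm⟩ := (extReesAlgebra.mem_strictTransform_iff I).mp hg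
    rw [Ideal.mem_comap]
    refine Submodule.mem_iSup_of_mem m (Submodule.mem_colon_singleton.mpr ?_)
    rw [smul_eq_mul, ← map_pow, ← map_mul, mul_comm]
    exact Ideal.mem_map_of_mem ψ hm
  · rw [← map_pow, colon_singleton_map_of_ringHom_flat hψ]
    refine Ideal.map_mono fun r hr => (extReesAlgebra.mem_strictTransform_iff I).mpr ⟨N, ?_⟩
    rw [mul_comm]
    exact Submodule.mem_colon_singleton.mp hr

/-! ## The cobordant blow-up: germs, stalk ideals, flatness -/

section Chart

variable {Y : Scheme.{u}} (U : Y.affineOpens) (I : ℕ → Ideal Γ(Y, U))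

/-- **The stalk map of `πY : B → Spec A ≅ U ⊆ Y` on germs**: for a section `a ∈ Γ(Y, U) = A`, the stalk
map at `b` takes the germ of `a` at `πY b` to the germ at `b` of the global section `a ∈ E = Γ(B)`.
[folklore] -/
theorem stalkMap_germ_π_fromSpec (b : affineCobordantBlowup I)
    (hyU : (affineCobordantBlowup.π I ≫ U.2.fromSpec) b ∈ (U : Y.Opens)) (a : Γ(Y, U)) :
    ((affineCobordantBlowup.π I ≫ U.2.fromSpec).stalkMap b).hom
        ((Y.presheaf.germ U _ hyU).hom a) =
      ((affineCobordantBlowup I).presheaf.germ ⊤ b trivial).hom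
        ((Scheme.ΓSpecIso (.of (extReesAlgebra I))).inv.hom
          (algebraMap _ (extReesAlgebra I) a)) := by
  -- through `U.2.fromSpec`: the germ of `a` goes to the germ of `a ∈ A = Γ(Spec A)`
  have h1 : ∀ (p : Spec Γ(Y, U)) (hp : U.2.fromSpec p ∈ (U : Y.Opens)),
      (U.2.fromSpec.stalkMap p).hom ((Y.presheaf.germ U _ hp).hom a) =
        ((Spec Γ(Y, U)).presheaf.germ ⊤ p trivial).hom ((Scheme.ΓSpecIso Γ(Y, U)).inv.hom a) := by
    intro p hp
    have := Scheme.Hom.germ_stalkMap_apply U.2.fromSpec U p hp a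
    rw [IsAffineOpen.fromSpec_app_self, CommRingCat.comp_apply,
      TopCat.Presheaf.germ_res_apply] at this
    exact this
  -- through `π = Spec (A → E)`: naturality of `ΓSpecIso`
  have h2 : ∀ t : Γ(Spec Γ(Y, U), ⊤), ((affineCobordantBlowup.π I).stalkMap b).hom
      (((Spec Γ(Y, U)).presheaf.germ ⊤ (affineCobordantBlowup.π I b) trivial).hom t) =
      ((affineCobordantBlowup I).presheaf.germ ⊤ b trivial).hom
        ((affineCobordantBlowup.π I).appTop.hom t) :=
    fun t => Scheme.Hom.germ_stalkMap_apply (affineCobordantBlowup.π I) ⊤ b trivial t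
  have h3 : (affineCobordantBlowup.π I).appTop.hom ((Scheme.ΓSpecIso Γ(Y, U)).inv.hom a) =
      (Scheme.ΓSpecIso (.of (extReesAlgebra I))).inv.hom (algebraMap _ (extReesAlgebra I) a) := by
    have h := congrArg (fun φ => φ.hom a) (Scheme.ΓSpecIso_inv_naturality
      (CommRingCat.ofHom (algebraMap Γ(Y, U) (extReesAlgebra I))))
    simp only [CommRingCat.hom_comp, RingHom.comp_apply, CommRingCat.hom_ofHom] at h
    exact h.symm
  rw [Scheme.Hom.stalkMap_comp, ← h3, ← h2]
  exact congrArg ((affineCobordantBlowup.π I).stalkMap b).hom (h1 (affineCobordantBlowup.π I b) hyU)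

/-- **The stalk of the ideal sheaf of an ideal of global sections**: on any affine open `V ∋ x`, the
germs at `x` of the sections of `ofIdealTop J` over `V` generate `J 𝒪_{X,x}`. [folklore] -/
theorem map_germ_ofIdealTop_ideal {X : Scheme.{u}} (J : Ideal Γ(X, ⊤)) (x : X)
    (V : X.affineOpens) (hxV : x ∈ (V : X.Opens)) :
    ((Scheme.IdealSheafData.ofIdealTop J).ideal V).map (X.presheaf.germ V x hxV).hom =
      J.map (X.presheaf.germ ⊤ x trivial).hom := by
  rw [Scheme.IdealSheafData.ofIdealTop_ideal, Ideal.map_map, ← CommRingCat.hom_comp,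
    TopCat.Presheaf.germ_res]

/-- **The stalk of the ideal sheaf of `J ≤ E` on `B = Spec E`**: on any affine open `V ∋ b`, the germs
at `b` of the sections of `idealSheaf I J` over `V` generate `J 𝒪_{B,b}` (the image of `J` under
`E = Γ(B) → 𝒪_{B,b}`). [folklore] -/
theorem map_germ_idealSheaf_ideal (J : Ideal (extReesAlgebra I)) (b : affineCobordantBlowup I)
    (V : (affineCobordantBlowup I).affineOpens) (hbV : b ∈ (V : (affineCobordantBlowup I).Opens)) :
    ((affineCobordantBlowup.idealSheaf I J).ideal V).map
        ((affineCobordantBlowup I).presheaf.germ V b hbV).hom =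
      J.map (((affineCobordantBlowup I).presheaf.germ ⊤ b trivial).hom.comp
        (Scheme.ΓSpecIso (.of (extReesAlgebra I))).inv.hom) := by
  rw [affineCobordantBlowup.idealSheaf, map_germ_ofIdealTop_ideal]
  exact Ideal.map_map _ _

/-- **`E = Γ(B) → 𝒪_{B,b}` is flat**: `Γ(B) → 𝒪_{B,b}` is a localisation at a prime
(`IsAffineOpen.isLocalization_stalk`), and localisations are flat (`IsLocalization.flat`). [folklore] -/
theorem flat_germ_comp_ΓSpecIso (b : affineCobordantBlowup I) :
    ((((affineCobordantBlowup I).presheaf.germ ⊤ b trivial).hom.comp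
      (Scheme.ΓSpecIso (.of (extReesAlgebra I))).inv.hom)).Flat := by
  refine RingHom.Flat.comp ?_ ?_
  · exact RingHom.Flat.of_bijective
      (Scheme.ΓSpecIso (.of (extReesAlgebra I))).commRingCatIsoToRingEquiv.symm.bijective
  · haveI : IsAffine (affineCobordantBlowup I) := by
      unfold affineCobordantBlowup
      infer_instance
    letI := (affineCobordantBlowup I).presheaf.algebra_section_stalk (U := ⊤) ⟨b, trivial⟩
    have hloc := (isAffineOpen_top (affineCobordantBlowup I)).isLocalization_stalk ⟨b, trivial⟩
    have hflat := IsLocalization.flat ((affineCobordantBlowup I).presheaf.stalk b)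
      ((isAffineOpen_top (affineCobordantBlowup I)).primeIdealOf ⟨b, trivial⟩).asIdeal.primeCompl
    exact RingHom.flat_algebraMap_iff.mpr hflat

/-- **The completed strict transform in formal coordinates** (general form): for a scheme `Y`, an
affine open `U`, a filtration `I` on `A = Γ(Y, U)`, a point `b` of `B = Spec A[t⁻¹, Iₙ tⁿ]` with
Noetherian local ring, ring isomorphisms `eY : 𝒪̂_{Y,πY b} ≃ SY`, `eB : 𝒪̂_{B,b} ≃ SB`, a map `Φ` with
`eB ∘ π̂Y = Φ ∘ eY` and `eB(t⁻¹) = x₀`: the image under `eB` of the completed stalk ideal at `b` of the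
strict transform `σˢ(X(U))` is the `x₀`-saturation `⋃_N (J : x₀ᴺ)` of the ideal `J` generated by
`Φ(eY(X(U) 𝒪̂_{Y, πY b}))` — the completion of a Noetherian ring being flat (Mathlib
`AdicCompletion.flat_of_isNoetherian`). [cite: Wlodarczyk2022, 3.3.12] -/
theorem map_completedStalkIdeal_idealSheaf_strictTransform (b : affineCobordantBlowup I)
    (hN : IsNoetherianRing ((affineCobordantBlowup I).presheaf.stalk b))
    (hyU : (affineCobordantBlowup.π I ≫ U.2.fromSpec) b ∈ (U : Y.Opens))
    {SY SB : Type*} [CommRing SY] [CommRing SB]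
    (eY : AdicCompletion (IsLocalRing.maximalIdeal
        (Y.presheaf.stalk ((affineCobordantBlowup.π I ≫ U.2.fromSpec) b)))
        (Y.presheaf.stalk ((affineCobordantBlowup.π I ≫ U.2.fromSpec) b)) ≃+* SY)
    (eB : AdicCompletion (IsLocalRing.maximalIdeal ((affineCobordantBlowup I).presheaf.stalk b))
        ((affineCobordantBlowup I).presheaf.stalk b) ≃+* SB)
    (Φ : SY → SB) (V : (affineCobordantBlowup I).affineOpens)
    (hbV : b ∈ (V : (affineCobordantBlowup I).Opens)) {x₀ : SB}
    (hs : eB (algebraMap _ _ (((affineCobordantBlowup I).presheaf.germ ⊤ b trivial).hom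
      ((Scheme.ΓSpecIso (.of (extReesAlgebra I))).inv.hom (extReesAlgebra.tInv I)))) = x₀)
    (hΦ : ∀ a, eB (DeJong1996.completedStalkMap (affineCobordantBlowup.π I ≫ U.2.fromSpec) b a) =
      Φ (eY a))
    (X : Y.IdealSheafData) :
    (completedStalkIdeal (affineCobordantBlowup.idealSheaf I
        (extReesAlgebra.strictTransform I (X.ideal U))) b V hbV).map eB.toRingHom =
      ⨆ N : ℕ, Submodule.colon
        (Ideal.span ((fun a => Φ (eY a)) ''
          (completedStalkIdeal X ((affineCobordantBlowup.π I ≫ U.2.fromSpec) b) U hyU : Set _)))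
        (Ideal.span {x₀ ^ N}) := by
  haveI := hN
  -- notation: `ψ : E → 𝒪_{B,b} → 𝒪̂_{B,b} ≃ SB`, `χ = eB ∘ π̂Y : 𝒪̂_{Y,y} → SB`
  obtain ⟨ψ, hψ⟩ : ∃ ψ : extReesAlgebra I →+* SB, ψ = (eB.toRingHom.comp (algebraMap _ _)).comp
      (((affineCobordantBlowup I).presheaf.germ ⊤ b trivial).hom.comp
        (Scheme.ΓSpecIso (.of (extReesAlgebra I))).inv.hom) := ⟨_, rfl⟩
  obtain ⟨χ, hχ⟩ : ∃ χ : _ →+* SB, χ = eB.toRingHom.comp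
      (DeJong1996.completedStalkMap (affineCobordantBlowup.π I ≫ U.2.fromSpec) b) := ⟨_, rfl⟩
  have hψflat : ψ.Flat := by
    rw [hψ]
    exact RingHom.Flat.comp (flat_germ_comp_ΓSpecIso U I b) (RingHom.Flat.comp
      (RingHom.flat_algebraMap_iff.mpr (AdicCompletion.flat_of_isNoetherian _))
      (RingHom.Flat.of_bijective eB.bijective))
  -- the left-hand side is `σˢ(𝔞) SB`
  have hL : (completedStalkIdeal (affineCobordantBlowup.idealSheaf I
      (extReesAlgebra.strictTransform I (X.ideal U))) b V hbV).map eB.toRingHom =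
      (extReesAlgebra.strictTransform I (X.ideal U)).map ψ := by
    rw [completedStalkIdeal, map_germ_idealSheaf_ideal, Ideal.map_map, Ideal.map_map, hψ]
  -- the generating set on the right is the image of `X(U)` under `χ ∘ (A → 𝒪̂_{Y,y}) = ψ ∘ (A → E)`
  have hΦχ : (fun a => Φ (eY a)) = χ := funext fun a => by
    rw [hχ]
    exact (hΦ a).symm
  have hcomp : (χ.comp (algebraMap _ _)).comp
      (Y.presheaf.germ U ((affineCobordantBlowup.π I ≫ U.2.fromSpec) b) hyU).hom =
      ψ.comp (algebraMap Γ(Y, U) (extReesAlgebra I)) := by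
    -- the completed stalk map extends the stalk map
    have hof : ∀ t, DeJong1996.completedStalkMap (affineCobordantBlowup.π I ≫ U.2.fromSpec) b
        (algebraMap _ _ t) =
        algebraMap _ _ (((affineCobordantBlowup.π I ≫ U.2.fromSpec).stalkMap b).hom t) :=
      fun t => DeJong1996.completedStalkMap_of _ _ t
    refine RingHom.ext fun a => ?_
    rw [hχ, hψ]
    simp only [RingHom.comp_apply]
    rw [hof, stalkMap_germ_π_fromSpec U I b hyU a]
    rfl
  have hR : Ideal.span ((fun a => Φ (eY a)) ''
      (completedStalkIdeal X ((affineCobordantBlowup.π I ≫ U.2.fromSpec) b) U hyU : Set _)) =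
      ((X.ideal U).map (algebraMap Γ(Y, U) (extReesAlgebra I))).map ψ := by
    rw [hΦχ, completedStalkIdeal]
    change Ideal.map χ _ = _
    rw [Ideal.map_map, Ideal.map_map, hcomp, ← Ideal.map_map]
  have hs' : ψ (extReesAlgebra.tInv I) = x₀ := by
    rw [hψ]
    exact hs
  rw [hL, hR, ← hs']
  simp_rw [Ideal.colon_span]
  exact extReesAlgebra.map_strictTransform_eq_iSup_colon I hψflat (X.ideal U)

end Chart

/-! ## The stub -/

/-- `stub_formalStrictTransform`: **the completed strict transform is the `s`-saturation of the
substituted ideal.** For a regular weighted centre `R` on the smooth `Y`, an affine chart `U`, a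
point `b̄` of the full cobordant blow-up `B(U)` over `y ∈ U` and ANY ring isomorphisms
`eY : 𝒪̂_{Y,y} ≃ k⟦X₁, …, X_d⟧`, `eB : 𝒪̂_{B(U),b̄} ≃ k⟦X₀, …, X_d⟧` with `eB(t⁻¹) = X₀` under which the
completed stalk map is `Φ`, the completed stalk ideal of the strict transform `σˢ(X(U))` at `b̄`
corresponds to `⋃_N (J : X₀ᴺ)`, `J` the ideal generated by `Φ(eY(X(U) 𝒪̂_{Y,y}))`: the strict
transform is the `t⁻¹`-saturation of `X(U) E` (Włodarczyk 3.3.12) and saturation commutes with the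
flat passage `E → 𝒪_{B,b̄} → 𝒪̂_{B,b̄}` (Matsumura Thm. 7.4, 8.8; `𝒪_{B,b̄}` is Noetherian since `B(U)`
is regular, W 2.3.9). [cite: Wlodarczyk2022, 3.3.12] -/
theorem stub_formalStrictTransform :
    ∀ (k : Type) [Field k] ⦃Y : Scheme.{0}⦄ (f : Y ⟶ Spec (.of k)) [Smooth f] [IsSeparated f] [QuasiCompact f]
      (R : ReesAlgebraData Y), R.IsRegularWeightedCentre → ∀ (U : Y.affineOpens) (d : ℕ)
      (b : affineCobordantBlowup (R.chartIdeals U))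
      (hyU : (affineCobordantBlowup.π (R.chartIdeals U) ≫ U.2.fromSpec) b ∈ (U : Y.Opens))
      (eY : AdicCompletion (IsLocalRing.maximalIdeal
          (Y.presheaf.stalk ((affineCobordantBlowup.π (R.chartIdeals U) ≫ U.2.fromSpec) b)))
          (Y.presheaf.stalk ((affineCobordantBlowup.π (R.chartIdeals U) ≫ U.2.fromSpec) b)) ≃+* MvPowerSeries (Fin d) k)
      (eB : AdicCompletion (IsLocalRing.maximalIdeal ((affineCobordantBlowup (R.chartIdeals U)).presheaf.stalk b))
          ((affineCobordantBlowup (R.chartIdeals U)).presheaf.stalk b) ≃+* MvPowerSeries (Fin (d + 1)) k)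
      (Φ : MvPowerSeries (Fin d) k → MvPowerSeries (Fin (d + 1)) k)
      (V : (affineCobordantBlowup (R.chartIdeals U)).affineOpens)
      (hbV : b ∈ (V : (affineCobordantBlowup (R.chartIdeals U)).Opens)),
      eB (algebraMap _ _ (((affineCobordantBlowup (R.chartIdeals U)).presheaf.germ ⊤ b trivial).hom
          ((Scheme.ΓSpecIso (.of (extReesAlgebra (R.chartIdeals U)))).inv.hom
            (extReesAlgebra.tInv (R.chartIdeals U))))) = MvPowerSeries.X 0 →
      (∀ a, eB (DeJong1996.completedStalkMap (affineCobordantBlowup.π (R.chartIdeals U) ≫ U.2.fromSpec) b a) = Φ (eY a)) →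
      ∀ (X : Y.IdealSheafData),
      (completedStalkIdeal (affineCobordantBlowup.idealSheaf (R.chartIdeals U)
          (extReesAlgebra.strictTransform (R.chartIdeals U) (X.ideal U))) b V hbV).map eB.toRingHom =
        ⨆ N : ℕ, Submodule.colon
          (Ideal.span ((fun a => Φ (eY a)) ''
            (completedStalkIdeal X ((affineCobordantBlowup.π (R.chartIdeals U) ≫ U.2.fromSpec) b) U hyU : Set _)))
          (Ideal.span {(MvPowerSeries.X (0 : Fin (d + 1)) : MvPowerSeries (Fin (d + 1)) k) ^ N}) := by
  intro k _ Y f _ _ _ R hR U d b hyU eY eB Φ V hbV hs hΦ X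
  -- `𝒪_{B(U),b}` is Noetherian: `B(U)` is a regular scheme (W 2.3.9, landed)
  have hN : IsNoetherianRing ((affineCobordantBlowup (R.chartIdeals U)).presheaf.stalk b) :=
    ((stub_cobordantBlowup_regular stub_extRees_bridge f R hR U).1 b).toIsNoetherian
  exact map_completedStalkIdeal_idealSheaf_strictTransform U (R.chartIdeals U) b hN hyU eY eB Φ V
    hbV hs hΦ X

end Summit.ResolutionOfSingularities.ResolutionOfSingularities.Theorems

end
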